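import Summits.NavierStokesRegularity.NavierStokesRegularity.Theorems.SwirlHolderTowerFunnelCalculus
import Summits.NavierStokesRegularity.NavierStokesRegularity.Theorems.SwirlHolderTowerFunnelDrift
import HarnessLib

/-!
# SwirlHolderTower, part 3c — `FunnelSeparation` HOLDS: the funnel carries the separable steady
# passive swirls (ROUND-15 typing request T-15.3 discharged; seat nsreg-p4)

Support file for the DORMANT route `SwirlThreshold` (crux stmt-NavierStokesRegularity-2002).
`…Theorems.SwirlHolderTowerFunnel` proved the kernel ceiling on every LINEAR swirl Hölder law,
`linearHolderLaw_ceiling (hsep : FunnelSeparation) (hexp : FunnelExponent) …`, from two classical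
packages taken as hypotheses.  This file proves the first one:

* `funnel_swirl_equation`: for every solution `G` of the angular problem `FunnelODE N γ G m t₀`,
  the separable function `Θ = |x|^γ G(x₃/|x|)` solves the STEADY SWIRL EQUATION
  `u_N·∇Θ = ΔΘ - (2/r) ∂_r Θ` off the axis, with the funnel drift `u_N` (parts 3a/3b supply
  `ΔΘ`, `DΘ`, `⟪x, u_N⟫`, `(u_N)₃`, `⟪x, e_r⟫`; the residual is `-|x|^{γ-2}` times the ODE);
* `continuous_separableSwirl` (squeeze at the origin from `0 ≤ Θ ≤ m|x|^γ`),
  `contDiffOn_separableSwirl` (`C²` off the origin), `separableSwirl_eq_zero_of_cylRadius_eq_zero`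
  (`G(±1) = 0`);
* `isSteadyPassiveSwirl_funnel` and **`funnelSeparation_holds : FunnelSeparation`**;
* the ceiling with ONE hypothesis left: `linearHolderLaw_ceiling_of_funnelExponent`
  (`FunnelExponent → LinearHolderLaw γ → γ N ≤ 2√(N/π)e^{-N/4}` for `N ≥ 16`) and
  `not_linearPolyHolderLaw_of_funnelExponent`.

What remains hypothetical is `FunnelExponent` alone — the ODE fact that the angular problem has a
positive solution with exponent `≤ 2√(N/π)e^{-N/4}` for `N ≥ 16` (numerics: kit job j269992;
certified interval version = test T-15.2).
WHAT THIS IS NOT: not NS regularity — a classical verification serving a ceiling on LINEAR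
(passive-scalar) methods; `PolyHolderLaw` for Navier–Stokes solutions stays open; hard cores
untouched; no crux claim.
-/

namespace Summit.NavierStokesRegularity.NavierStokesRegularity.Theorems.SwirlHolderTower

open Set Filter Topology Metric
open scoped Laplacian RealInnerProductSpace
open Literature.Analysis Literature.Analysis.FluidPDE

noncomputable section

variable {N γ m t₀ : ℝ} {G : ℝ → ℝ}

/-! ### The separable swirl in profile form -/

/-- `separableSwirl γ G = (y ↦ (‖y‖²)^{γ/2} G(y₂ (‖y‖²)^{-1/2}))` (everywhere, both junk values at
the origin agreeing). -/
theorem separableSwirl_eq_profile (γ : ℝ) (G : ℝ → ℝ) :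
    separableSwirl γ G = fun y : EuclideanSpace ℝ (Fin 3) =>
      (‖y‖ ^ 2) ^ (γ / 2) * G (y 2 * (‖y‖ ^ 2) ^ (-(1 / 2 : ℝ))) := by
  funext y
  rw [separableSwirl, norm_sq_rpow_half, tau_eq]

/-- `Θ(0) = 0` for `γ > 0`. -/
theorem separableSwirl_zero (hγ : 0 < γ) (G : ℝ → ℝ) :
    separableSwirl γ G (0 : EuclideanSpace ℝ (Fin 3)) = 0 := by
  simp [separableSwirl, Real.zero_rpow hγ.ne']

/-- **`Θ` is `C²` off the origin** (for `G ∈ C²`). -/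
theorem contDiffOn_separableSwirl (hG : ContDiff ℝ 2 G) (γ : ℝ) :
    ContDiffOn ℝ 2 (separableSwirl γ G) {x : EuclideanSpace ℝ (Fin 3) | x ≠ 0} := by
  rw [separableSwirl_eq_profile]
  exact fun x hx => (contDiffAt_rpow_mul_comp_tau hG γ hx).contDiffWithinAt

/-- **`Θ` is continuous on `ℝ³`**: off the origin it is `C²`; at the origin `0 ≤ Θ(y) ≤ m‖y‖^γ → 0`
(`separableSwirl_bounds`, `γ > 0`). -/
theorem continuous_separableSwirl (hode : FunnelODE N γ G m t₀) (hγ : 0 < γ) :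
    Continuous (separableSwirl γ G) := by
  have hG : ContDiff ℝ 2 G := hode.1
  refine continuous_iff_continuousAt.2 fun y => ?_
  by_cases hy : y = 0
  · subst hy
    have hup : Tendsto (fun z : EuclideanSpace ℝ (Fin 3) => m * ‖z‖ ^ γ) (𝓝 0) (𝓝 0) := by
      have hc : Continuous (fun z : EuclideanSpace ℝ (Fin 3) => m * ‖z‖ ^ γ) :=
        continuous_const.mul (continuous_norm.rpow_const fun _ => Or.inr hγ.le)
      simpa [Real.zero_rpow hγ.ne'] using hc.tendsto 0
    rw [ContinuousAt, separableSwirl_zero hγ]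
    exact tendsto_of_tendsto_of_tendsto_of_le_of_le tendsto_const_nhds hup
      (fun z => (separableSwirl_bounds hode z).1) (fun z => (separableSwirl_bounds hode z).2)
  · rw [separableSwirl_eq_profile]
    exact (contDiffAt_rpow_mul_comp_tau hG γ hy).continuousAt

/-- **`Θ` vanishes on the axis**: there `x₃/|x| = ±1` (or `x = 0`) and `G(±1) = 0`. -/
theorem separableSwirl_eq_zero_of_cylRadius_eq_zero (hode : FunnelODE N γ G m t₀) (hγ : 0 < γ)
    {y : EuclideanSpace ℝ (Fin 3)} (hy : cylRadius y = 0) : separableSwirl γ G y = 0 := by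
  obtain ⟨-, h1, hm1, -⟩ := hode
  have hsq : ‖y‖ ^ 2 = |y 2| ^ 2 := by
    rw [norm_sq_eq_cylRadius_sq_add, hy, sq_abs]; ring
  have hn : ‖y‖ = |y 2| := by
    rw [← Real.sqrt_sq (norm_nonneg y), hsq, Real.sqrt_sq (abs_nonneg _)]
  unfold separableSwirl
  rw [hn]
  rcases lt_trichotomy (y 2) 0 with hlt | heq | hgt
  · rw [abs_of_neg hlt, div_neg, div_self hlt.ne, hm1, mul_zero]
  · rw [heq, abs_zero, Real.zero_rpow hγ.ne', zero_mul]
  · rw [abs_of_pos hgt, div_self hgt.ne', h1, mul_zero]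

/-! ### The steady swirl equation for the funnel pair -/

/-- Off the axis `x₃/|x| ∈ (-1, 1)`. -/
theorem div_norm_mem_Ioo {x : EuclideanSpace ℝ (Fin 3)} (hx : cylRadius x ≠ 0) :
    x 2 / ‖x‖ ∈ Ioo (-1 : ℝ) 1 := by
  have hr : 0 < cylRadius x := lt_of_le_of_ne (cylRadius_nonneg x) (Ne.symm hx)
  have hrel := norm_sq_eq_cylRadius_sq_add x
  have hρ : 0 < ‖x‖ := by
    have h2 : 0 < ‖x‖ ^ 2 := by rw [hrel]; positivity
    exact lt_of_le_of_ne (norm_nonneg x) fun h0 => by rw [← h0] at h2; norm_num at h2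
  have hlt : x 2 ^ 2 < ‖x‖ ^ 2 := by rw [hrel]; nlinarith
  have habs : |x 2| < ‖x‖ := abs_lt_of_sq_lt_sq hlt hρ.le
  rw [mem_Ioo, ← abs_lt, abs_div, abs_of_pos hρ, div_lt_one hρ]
  exact habs

/-- **THE STEADY SWIRL EQUATION FOR THE FUNNEL PAIR**: for a solution of the angular problem,
`u_N·∇Θ = ΔΘ - (2/r) ∂_r Θ` at every point off the axis (`Θ = |x|^γ G(x₃/|x|)`,
`∂_r = e_r·∇`): the residual is `-|x|^{γ-2}` times the ODE at `t = x₃/|x|`. -/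
theorem funnel_swirl_equation (hode : FunnelODE N γ G m t₀) {x : EuclideanSpace ℝ (Fin 3)}
    (hx : cylRadius x ≠ 0) :
    convect (funnelDrift N) (separableSwirl γ G) x =
      (Δ (separableSwirl γ G)) x - 2 / cylRadius x * partialDeriv (eR x) (separableSwirl γ G) x := by
  have hG : ContDiff ℝ 2 G := hode.1
  have hODE := hode.2.2.2.2.2.2.2 _ (div_norm_mem_Ioo hx)
  have hr : 0 < cylRadius x := lt_of_le_of_ne (cylRadius_nonneg x) (Ne.symm hx)
  have hx0 : x ≠ 0 := by
    rintro rfl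
    exact hx (by simp [cylRadius])
  have hρ : 0 < ‖x‖ := norm_pos_iff.mpr hx0
  rw [separableSwirl_eq_profile, convect_apply, partialDeriv_apply,
    fderiv_rpow_mul_comp_tau_apply hG γ hx0, fderiv_rpow_mul_comp_tau_apply hG γ hx0,
    laplacian_rpow_mul_comp_tau hG γ hx0, inner_self_funnelDrift N hx0, funnelDrift_apply_two,
    inner_self_eR hx, eR_apply_two]
  set ρ : ℝ := ‖x‖ with hρdef
  set r : ℝ := cylRadius x with hrdef
  set Q : ℝ := ‖x‖ ^ γ with hQ
  have hρ0 : ρ ≠ 0 := hρ.ne'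
  field_simp
  field_simp at hODE
  linear_combination (-(Q * r)) * hODE

/-- **The funnel pair is a steady passive swirl pair of gauge `N`** (`IsSteadyPassiveSwirl`):
drift bound, smoothness and `div u_N = 0` off the origin (part 3b), continuity, `C²`-smoothness
off the origin and vanishing on the axis of `Θ`, and the steady swirl equation off the axis. -/
theorem isSteadyPassiveSwirl_funnel (hN : 0 ≤ N) (hγ : 0 < γ) (hode : FunnelODE N γ G m t₀) :
    IsSteadyPassiveSwirl N (funnelDrift N) (separableSwirl γ G) :=
  ⟨fun _ hx => norm_funnelDrift_le hN hx, contDiffOn_funnelDrift N,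
    fun _ hx => divergence_funnelDrift N hx, continuous_separableSwirl hode hγ,
    contDiffOn_separableSwirl hode.1 γ, fun _ hy => separableSwirl_eq_zero_of_cylRadius_eq_zero hode hγ hy,
    fun _ hx => funnel_swirl_equation hode hx⟩

/-- **`FunnelSeparation` HOLDS** (ROUND-15 T-15.3): every solution of the angular problem gives a
steady passive swirl pair `(u_N, |x|^γ G(x₃/|x|))` of gauge `N`. -/
theorem funnelSeparation_holds : FunnelSeparation :=
  fun _ _ _ _ _ hN hγ hode => isSteadyPassiveSwirl_funnel hN hγ hode

/-! ### The ceiling with the single remaining hypothesis `FunnelExponent` -/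

/-- **CEILING ON EVERY LINEAR HÖLDER LAW, modulo the ODE fact only**: given `FunnelExponent`, any
Hölder law valid for steady passive swirl pairs has profile `γ(N) ≤ 2√(N/π) e^{-N/4}` for all
`N ≥ 16` (`linearHolderLaw_ceiling` with `FunnelSeparation` discharged). -/
theorem linearHolderLaw_ceiling_of_funnelExponent (hexp : FunnelExponent) {γ : ℝ → ℝ}
    (hlaw : LinearHolderLaw γ) {N : ℝ} (hN : 16 ≤ N) : γ N ≤ 2 * funnelGamma N :=
  linearHolderLaw_ceiling funnelSeparation_holds hexp hlaw hN

/-- **NO POLYNOMIAL HÖLDER LAW FOR PASSIVE SWIRLS, modulo the ODE fact only**: given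
`FunnelExponent`, for every `p, c > 0` the law with profile `c(1+N)^{-p}` fails on the linear
class. -/
theorem not_linearPolyHolderLaw_of_funnelExponent (hexp : FunnelExponent) {p c : ℝ} (hp : 0 < p)
    (hc : 0 < c) : ¬ LinearHolderLaw (fun N => c * (1 + N) ^ (-p)) :=
  not_linearPolyHolderLaw funnelSeparation_holds hexp hp hc

end

end Summit.NavierStokesRegularity.NavierStokesRegularity.Theorems.SwirlHolderTower
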